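import Summits.AtomisticToContinuum.Crystallization.Theorems.SquareWellLayerCakeGapTwelveToBarlowFiveFoldRing2

/-!
# Five-fold continuation (S2β) — part 1: frame lemmas and the overlap lemma

Crux `SquareWellLayerCake.GapTwelveToBarlow` (stmt-AtomisticToContinuum-15807), line `Sketch`,
stub `stub_fiveFoldContinuation` (a site with one five-fold bond has exactly two, nearly
antipodal).  Vocabulary as in the ring files (`FiveFoldRing1–3`): a bond `(j, k)` is
five-fold when it has exactly five common neighbours within `1`; its ring is that set.
In the transversal frame of a bond (`transversal_frame`: unit complex directions with pairwise
`Re ≤ 2/5`, `≤ -1/9` for pairs `≥ 131/100` apart, `> 0` for bonded pairs) three planar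
facts are recorded and used:

* `one_lt_norm_sub_of_re_le` — directions are pairwise more than `1` apart, whence
  `card_common_le_five`: the sign lemma (at most five common neighbours) under the LOCAL
  separation hypothesis of the stubs (sites within `11/10` of `x j` are `55/57`-separated);
* `not_three_unit_pairwise_bonded` — whence `not_three_bonded_common`: no three common
  neighbours of a bond are pairwise bonded (in a closed five-ring the two partners of a ring
  site are far from each other);
* `not_cross_bonded_of_two_far_pairs` — two far pairs cannot be completely cross-bonded;

and the **overlap lemma** `card_eq_five_of_mem_inter`: under the local dichotomy, if two
five-fold bonds `(j, k)`, `(j, k')` with `|x k - x k'| > 1` share a ring site `w`, then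
`(j, w)` is five-fold — an ADJACENT five-fold bond.  Hence "no adjacent five-fold bonds"
makes the rings of far five-fold bonds disjoint (part 2).  `stub_fiveFoldOverlap` is the
registered closed form.

Mathlib + the landed ring files only; no named fact is used.
-/

noncomputable section

namespace Summit.AtomisticToContinuum.Crystallization.Theorems.SquareWellLayerCakeGapTwelveToBarlow

open scoped InnerProductSpace ComplexConjugate Real

/-! ## Planar lemmas -/

/-- Unit complex numbers with `Re (z conj w) ≤ 2/5` are more than `1` apart
(`‖z - w‖² = 2 - 2 Re (z conj w) ≥ 6/5`). [folklore] -/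
theorem one_lt_norm_sub_of_re_le {z w : ℂ} (hz : ‖z‖ = 1) (hw : ‖w‖ = 1)
    (h : (z * conj w).re ≤ 2 / 5) : 1 < ‖z - w‖ := by
  have hz2 : z.re ^ 2 + z.im ^ 2 = 1 := by
    have h := Complex.sq_norm z
    rw [Complex.normSq_apply, hz, one_pow] at h
    nlinarith [h]
  have hw2 : w.re ^ 2 + w.im ^ 2 = 1 := by
    have h := Complex.sq_norm w
    rw [Complex.normSq_apply, hw, one_pow] at h
    nlinarith [h]
  rw [re_mul_conj] at h
  have hsq : 1 < ‖z - w‖ ^ 2 := by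
    rw [Complex.sq_norm, Complex.normSq_apply, Complex.sub_re, Complex.sub_im]
    nlinarith [hz2, hw2, h]
  nlinarith [norm_nonneg (z - w), hsq]

/-- **No three pairwise bonded transversal directions.**  Three unit complex numbers cannot
have all three pairwise `Re (· conj ·)` in `(0, 2/5]` (pairwise angles in `[66°, 90°)`):
rotating `a` to `1`, the other two have real parts in `(0, 2/5]`, so imaginary parts of
absolute value `≥ √21/5`; same signs give `Re ≥ 21/25 > 2/5`, opposite signs give `Re < 0`.
[folklore] -/
theorem not_three_unit_pairwise_bonded {a b c : ℂ} (ha : ‖a‖ = 1) (hb : ‖b‖ = 1) (hc : ‖c‖ = 1)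
    (hab0 : 0 < (a * conj b).re) (hab1 : (a * conj b).re ≤ 2 / 5)
    (hac0 : 0 < (a * conj c).re) (hac1 : (a * conj c).re ≤ 2 / 5)
    (hbc0 : 0 < (b * conj c).re) (hbc1 : (b * conj c).re ≤ 2 / 5) : False := by
  -- rotate by `conj a`
  have haa : a * conj a = 1 := by
    rw [Complex.mul_conj, Complex.normSq_eq_norm_sq, ha]; norm_num
  set p := b * conj a with hp
  set q := c * conj a with hq
  have hp1 : ‖p‖ = 1 := by rw [hp, norm_mul, Complex.norm_conj, ha, hb, one_mul]
  have hq1 : ‖q‖ = 1 := by rw [hq, norm_mul, Complex.norm_conj, ha, hc, one_mul]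
  have hpre : p.re = (a * conj b).re := by
    rw [hp, ← Complex.conj_re (b * conj a), map_mul, Complex.conj_conj, mul_comm]
  have hqre : q.re = (a * conj c).re := by
    rw [hq, ← Complex.conj_re (c * conj a), map_mul, Complex.conj_conj, mul_comm]
  have hpq : (p * conj q).re = (b * conj c).re := by rw [hp, hq, re_rot_mul_conj_rot haa]
  have hp2 : p.re ^ 2 + p.im ^ 2 = 1 := by
    have h := Complex.sq_norm p
    rw [Complex.normSq_apply, hp1, one_pow] at h
    nlinarith [h]
  have hq2 : q.re ^ 2 + q.im ^ 2 = 1 := by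
    have h := Complex.sq_norm q
    rw [Complex.normSq_apply, hq1, one_pow] at h
    nlinarith [h]
  rw [← hpre] at hab0 hab1
  rw [← hqre] at hac0 hac1
  rw [← hpq, re_mul_conj] at hbc0 hbc1
  have hpi : 21 / 25 ≤ p.im ^ 2 := by nlinarith
  have hqi : 21 / 25 ≤ q.im ^ 2 := by nlinarith
  rcases le_total 0 (p.im * q.im) with hs | hs
  · -- same side: `Re ≥ p.im q.im ≥ 21/25`
    have hsq : (21 / 25 : ℝ) * (21 / 25) ≤ (p.im * q.im) ^ 2 := by
      rw [mul_pow]; exact mul_le_mul hpi hqi (by norm_num) (le_trans (by norm_num) hpi)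
    have : 21 / 25 ≤ p.im * q.im := by nlinarith
    nlinarith [mul_pos hab0 hac0]
  · -- opposite sides: `Re ≤ p.re q.re + p.im q.im ≤ 4/25 - 21/25 < 0`
    have hsq : (21 / 25 : ℝ) * (21 / 25) ≤ (p.im * q.im) ^ 2 := by
      rw [mul_pow]; exact mul_le_mul hpi hqi (by norm_num) (le_trans (by norm_num) hpi)
    have : p.im * q.im ≤ -(21 / 25) := by nlinarith
    nlinarith [mul_le_mul hab1 hac1 hac0.le (by norm_num : (0:ℝ) ≤ 2 / 5)]

/-- **Two far pairs cannot be cross-bonded.**  Unit complex numbers `z₁, z₂` (far: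
`Re (z₁ conj z₂) ≤ -1/9`) and `u₁, u₂` (far) with all four cross pairs bonded
(`Re (zᵢ conj uⱼ) > 0`) do not exist: rotating `z₁` to `1`, both `uⱼ` have positive real part,
and `Re (z₂ conj uⱼ) > 0` with `Re z₂ ≤ -1/9` forces `Im uⱼ` to have the sign of `Im z₂`; then
`Re (u₁ conj u₂) > 0`. [folklore] -/
theorem not_cross_bonded_of_two_far_pairs {z₁ z₂ u₁ u₂ : ℂ} (hz₁ : ‖z₁‖ = 1) (hz₂ : ‖z₂‖ = 1)
    (hu₁ : ‖u₁‖ = 1) (hu₂ : ‖u₂‖ = 1)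
    (hzz : (z₁ * conj z₂).re ≤ -1 / 9) (huu : (u₁ * conj u₂).re ≤ -1 / 9)
    (h11 : 0 < (z₁ * conj u₁).re) (h12 : 0 < (z₁ * conj u₂).re)
    (h21 : 0 < (z₂ * conj u₁).re) (h22 : 0 < (z₂ * conj u₂).re) : False := by
  have hzc : z₁ * conj z₁ = 1 := by
    rw [Complex.mul_conj, Complex.normSq_eq_norm_sq, hz₁]; norm_num
  set p := z₂ * conj z₁ with hp
  set a := u₁ * conj z₁ with ha
  set b := u₂ * conj z₁ with hb
  have hp1 : ‖p‖ = 1 := by rw [hp, norm_mul, Complex.norm_conj, hz₁, hz₂, one_mul]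
  have ha1 : ‖a‖ = 1 := by rw [ha, norm_mul, Complex.norm_conj, hz₁, hu₁, one_mul]
  have hb1 : ‖b‖ = 1 := by rw [hb, norm_mul, Complex.norm_conj, hz₁, hu₂, one_mul]
  have hre_rot : ∀ w : ℂ, (w * conj z₁).re = (z₁ * conj w).re := fun w => by
    rw [← Complex.conj_re (w * conj z₁), map_mul, Complex.conj_conj, mul_comm]
  have hpre : p.re ≤ -1 / 9 := by rw [hp, hre_rot]; exact hzz
  have hare : 0 < a.re := by rw [ha, hre_rot]; exact h11
  have hbre : 0 < b.re := by rw [hb, hre_rot]; exact h12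
  have hpa : 0 < (p * conj a).re := by rw [hp, ha, re_rot_mul_conj_rot hzc]; exact h21
  have hpb : 0 < (p * conj b).re := by rw [hp, hb, re_rot_mul_conj_rot hzc]; exact h22
  have hab : (a * conj b).re ≤ -1 / 9 := by rw [ha, hb, re_rot_mul_conj_rot hzc]; exact huu
  rw [re_mul_conj] at hpa hpb hab
  -- `p.im * a.im > -p.re * a.re > 0`, same for `b`: `a.im`, `b.im` have the sign of `p.im`
  have h1 : 0 < p.im * a.im := by nlinarith [mul_pos hare (by linarith : (0:ℝ) < -p.re)]
  have h2 : 0 < p.im * b.im := by nlinarith [mul_pos hbre (by linarith : (0:ℝ) < -p.re)]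
  have h3 : 0 < (p.im * a.im) * (p.im * b.im) := mul_pos h1 h2
  have h4 : 0 < a.im * b.im := by
    have : (p.im * a.im) * (p.im * b.im) = p.im ^ 2 * (a.im * b.im) := by ring
    rw [this] at h3
    exact pos_of_mul_pos_right h3 (sq_nonneg _)
  nlinarith [mul_pos hare hbre]

/-! ## Local form of the sign lemma, and no bonded triangle among common neighbours -/

/-- **At most five common neighbours (local separation).**  If the sites within `11/10` of
`x j` are `55/57`-separated from everything, a bond `(j, k)` has at most five common
neighbours within `1`: their unit transversal directions are pairwise more than `1` apart
(`transversal_frame`, `card_le_five_of_one_lt_norm_sub`). [folklore] -/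
theorem card_common_le_five {N : ℕ} (x : Fin N → EuclideanSpace ℝ (Fin 3)) (j k : Fin N)
    (hjk : j ≠ k) (hdjk : dist (x j) (x k) ≤ 1)
    (hsep : ∀ j' : Fin N, dist (x j) (x j') ≤ 11 / 10 → ∀ k' : Fin N, k' ≠ j' →
      (55 : ℝ) / 57 ≤ dist (x j') (x k')) :
    (Finset.univ.filter fun l : Fin N =>
        l ≠ j ∧ l ≠ k ∧ dist (x j) (x l) ≤ 1 ∧ dist (x k) (x l) ≤ 1).card ≤ 5 := by
  classical
  set S := Finset.univ.filter fun l : Fin N =>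
    l ≠ j ∧ l ≠ k ∧ dist (x j) (x l) ≤ 1 ∧ dist (x k) (x l) ≤ 1 with hSdef
  have hmem : ∀ l ∈ S, l ≠ j ∧ l ≠ k ∧ dist (x j) (x l) ≤ 1 ∧ dist (x k) (x l) ≤ 1 :=
    fun l hl => (Finset.mem_filter.mp hl).2
  have hsepj : ∀ k' : Fin N, k' ≠ j → (55 : ℝ) / 57 ≤ dist (x j) (x k') :=
    hsep j (by rw [dist_self]; norm_num)
  have hδd : (55 : ℝ) / 57 ≤ dist (x j) (x k) := hsepj k hjk.symm
  have hS : ∀ l ∈ S, (55 : ℝ) / 57 ≤ dist (x j) (x l) ∧ dist (x j) (x l) ≤ 1 ∧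
      (55 : ℝ) / 57 ≤ dist (x k) (x l) ∧ dist (x k) (x l) ≤ 1 := by
    intro l hl
    obtain ⟨hlj, hlk, hjl, hkl⟩ := hmem l hl
    exact ⟨hsepj l hlj, hjl, hsep k (by linarith) l hlk, hkl⟩
  have hSS : ∀ l ∈ S, ∀ l' ∈ S, l ≠ l' → (55 : ℝ) / 57 ≤ dist (x l) (x l') :=
    fun l hl l' _ hne => hsep l (by linarith [(hmem l hl).2.2.1]) l' hne.symm
  obtain ⟨z, hz1, hzall, -, -⟩ := transversal_frame x j k hδd hdjk S hS hSS
  exact card_le_five_of_one_lt_norm_sub S z hz1 fun l hl l' hl' hne =>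
    one_lt_norm_sub_of_re_le (hz1 l hl) (hz1 l' hl') (hzall l hl l' hl' hne)

/-- **No bonded triangle among the common neighbours of a bond.**  Three distinct common
neighbours of a bond `(j, k)` are never pairwise bonded (five mutually near-unit points do not
fit in `ℝ³`): in the transversal frame their directions would be three unit complex numbers
with pairwise `Re` in `(0, 2/5]` (`not_three_unit_pairwise_bonded`). [folklore] -/
theorem not_three_bonded_common {N : ℕ} (x : Fin N → EuclideanSpace ℝ (Fin 3)) (j k : Fin N)
    (hjk : j ≠ k) (hdjk : dist (x j) (x k) ≤ 1)
    (hsep : ∀ j' : Fin N, dist (x j) (x j') ≤ 11 / 10 → ∀ k' : Fin N, k' ≠ j' →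
      (55 : ℝ) / 57 ≤ dist (x j') (x k'))
    {a b c : Fin N}
    (ha : a ∈ (Finset.univ.filter fun l : Fin N =>
        l ≠ j ∧ l ≠ k ∧ dist (x j) (x l) ≤ 1 ∧ dist (x k) (x l) ≤ 1))
    (hb : b ∈ (Finset.univ.filter fun l : Fin N =>
        l ≠ j ∧ l ≠ k ∧ dist (x j) (x l) ≤ 1 ∧ dist (x k) (x l) ≤ 1))
    (hc : c ∈ (Finset.univ.filter fun l : Fin N =>
        l ≠ j ∧ l ≠ k ∧ dist (x j) (x l) ≤ 1 ∧ dist (x k) (x l) ≤ 1))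
    (hab : a ≠ b) (hac : a ≠ c) (hbc : b ≠ c)
    (hdab : dist (x a) (x b) ≤ 1) (hdac : dist (x a) (x c) ≤ 1) (hdbc : dist (x b) (x c) ≤ 1) :
    False := by
  classical
  set S := Finset.univ.filter fun l : Fin N =>
    l ≠ j ∧ l ≠ k ∧ dist (x j) (x l) ≤ 1 ∧ dist (x k) (x l) ≤ 1 with hSdef
  have hmem : ∀ l ∈ S, l ≠ j ∧ l ≠ k ∧ dist (x j) (x l) ≤ 1 ∧ dist (x k) (x l) ≤ 1 :=
    fun l hl => (Finset.mem_filter.mp hl).2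
  have hsepj : ∀ k' : Fin N, k' ≠ j → (55 : ℝ) / 57 ≤ dist (x j) (x k') :=
    hsep j (by rw [dist_self]; norm_num)
  have hδd : (55 : ℝ) / 57 ≤ dist (x j) (x k) := hsepj k hjk.symm
  have hS : ∀ l ∈ S, (55 : ℝ) / 57 ≤ dist (x j) (x l) ∧ dist (x j) (x l) ≤ 1 ∧
      (55 : ℝ) / 57 ≤ dist (x k) (x l) ∧ dist (x k) (x l) ≤ 1 := by
    intro l hl
    obtain ⟨hlj, hlk, hjl, hkl⟩ := hmem l hl
    exact ⟨hsepj l hlj, hjl, hsep k (by linarith) l hlk, hkl⟩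
  have hSS : ∀ l ∈ S, ∀ l' ∈ S, l ≠ l' → (55 : ℝ) / 57 ≤ dist (x l) (x l') :=
    fun l hl l' _ hne => hsep l (by linarith [(hmem l hl).2.2.1]) l' hne.symm
  obtain ⟨z, hz1, hzall, -, hzbond⟩ := transversal_frame x j k hδd hdjk S hS hSS
  exact not_three_unit_pairwise_bonded (hz1 a ha) (hz1 b hb) (hz1 c hc)
    (hzbond a ha b hb hdab) (hzall a ha b hb hab) (hzbond a ha c hc hdac) (hzall a ha c hc hac)
    (hzbond b hb c hc hdbc) (hzall b hb c hc hbc)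

/-! ## Overlapping rings force an adjacent five-fold bond -/

/-- **Overlap lemma.**  Let `(j, k)` and `(j, k')` be five-fold bonds at a site `j` whose
`11/10`-neighbourhood is `55/57`-separated, under the local dichotomy (`≤ 1` or `≥ 131/100`
among the sites within `1` of `x j`), with `|x k - x k'| > 1`.  If a site `w` is a common
neighbour of BOTH bonds, then the bond `(j, w)` is itself five-fold (and `w` is bonded to `k`:
an ADJACENT five-fold bond).  Proof: `w` has two ring partners `a, b` in the ring of `k` and two
`a', b'` in the ring of `k'`; all of `k, k', a, b, a', b'` are common neighbours of `(j, w)`, at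
most five exist (`card_common_le_five`), and `{a, b} = {a', b'}` is impossible: `a, b` would be
bonded to both `k` and `k'` while `a–b` and `k–k'` are far (`not_three_bonded_common`,
`not_cross_bonded_of_two_far_pairs` in the frame of `(j, w)`). [folklore] -/
theorem card_eq_five_of_mem_inter {N : ℕ} (x : Fin N → EuclideanSpace ℝ (Fin 3)) (j k k' : Fin N)
    (hsep : ∀ j' : Fin N, dist (x j) (x j') ≤ 11 / 10 → ∀ k'' : Fin N, k'' ≠ j' →
      (55 : ℝ) / 57 ≤ dist (x j') (x k''))
    (hgap : ∀ l l' : Fin N, dist (x j) (x l) ≤ 1 → dist (x j) (x l') ≤ 1 →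
      1 < dist (x l) (x l') → (131 : ℝ) / 100 ≤ dist (x l) (x l'))
    (hjk : j ≠ k) (hdjk : dist (x j) (x k) ≤ 1)
    (h5 : (Finset.univ.filter fun l : Fin N =>
        l ≠ j ∧ l ≠ k ∧ dist (x j) (x l) ≤ 1 ∧ dist (x k) (x l) ≤ 1).card = 5)
    (hjk' : j ≠ k') (hdjk' : dist (x j) (x k') ≤ 1)
    (h5' : (Finset.univ.filter fun l : Fin N =>
        l ≠ j ∧ l ≠ k' ∧ dist (x j) (x l) ≤ 1 ∧ dist (x k') (x l) ≤ 1).card = 5)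
    (hfar : 1 < dist (x k) (x k')) (w : Fin N)
    (hw : w ∈ (Finset.univ.filter fun l : Fin N =>
        l ≠ j ∧ l ≠ k ∧ dist (x j) (x l) ≤ 1 ∧ dist (x k) (x l) ≤ 1))
    (hw' : w ∈ (Finset.univ.filter fun l : Fin N =>
        l ≠ j ∧ l ≠ k' ∧ dist (x j) (x l) ≤ 1 ∧ dist (x k') (x l) ≤ 1)) :
    (Finset.univ.filter fun l : Fin N =>
        l ≠ j ∧ l ≠ w ∧ dist (x j) (x l) ≤ 1 ∧ dist (x w) (x l) ≤ 1).card = 5 := by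
  classical
  set R := Finset.univ.filter fun l : Fin N =>
    l ≠ j ∧ l ≠ k ∧ dist (x j) (x l) ≤ 1 ∧ dist (x k) (x l) ≤ 1 with hRdef
  set R' := Finset.univ.filter fun l : Fin N =>
    l ≠ j ∧ l ≠ k' ∧ dist (x j) (x l) ≤ 1 ∧ dist (x k') (x l) ≤ 1 with hR'def
  set Sw := Finset.univ.filter fun l : Fin N =>
    l ≠ j ∧ l ≠ w ∧ dist (x j) (x l) ≤ 1 ∧ dist (x w) (x l) ≤ 1 with hSwdef
  have hmemR : ∀ l, l ∈ R ↔ l ≠ j ∧ l ≠ k ∧ dist (x j) (x l) ≤ 1 ∧ dist (x k) (x l) ≤ 1 :=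
    fun l => by rw [hRdef, Finset.mem_filter]; exact ⟨fun h => h.2, fun h => ⟨Finset.mem_univ _, h⟩⟩
  have hmemR' : ∀ l, l ∈ R' ↔ l ≠ j ∧ l ≠ k' ∧ dist (x j) (x l) ≤ 1 ∧ dist (x k') (x l) ≤ 1 :=
    fun l => by rw [hR'def, Finset.mem_filter]; exact ⟨fun h => h.2, fun h => ⟨Finset.mem_univ _, h⟩⟩
  have hmemSw : ∀ l, l ∈ Sw ↔ l ≠ j ∧ l ≠ w ∧ dist (x j) (x l) ≤ 1 ∧ dist (x w) (x l) ≤ 1 :=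
    fun l => by rw [hSwdef, Finset.mem_filter]; exact ⟨fun h => h.2, fun h => ⟨Finset.mem_univ _, h⟩⟩
  obtain ⟨hwj, hwk, hdjw, hdkw⟩ := (hmemR w).1 hw
  obtain ⟨-, hwk', -, hdk'w⟩ := (hmemR' w).1 hw'
  -- the two ring partners of `w` in each ring
  have h2 := fiveFold_ring_closed x j k hjk hdjk hsep hgap h5 w hw
  have h2' := fiveFold_ring_closed x j k' hjk' hdjk' hsep hgap h5' w hw'
  obtain ⟨a, b, hab, hTab⟩ := Finset.card_eq_two.mp h2
  obtain ⟨a', b', hab', hTab'⟩ := Finset.card_eq_two.mp h2'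
  have hpart : ∀ l, l ∈ R.filter (fun l' => l' ≠ w ∧ dist (x w) (x l') ≤ 1) ↔
      l ∈ R ∧ l ≠ w ∧ dist (x w) (x l) ≤ 1 := fun l => Finset.mem_filter
  have hpart' : ∀ l, l ∈ R'.filter (fun l' => l' ≠ w ∧ dist (x w) (x l') ≤ 1) ↔
      l ∈ R' ∧ l ≠ w ∧ dist (x w) (x l) ≤ 1 := fun l => Finset.mem_filter
  obtain ⟨haR, haw, hdwa⟩ := (hpart a).1 (by rw [hTab]; simp)
  obtain ⟨hbR, hbw, hdwb⟩ := (hpart b).1 (by rw [hTab]; simp)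
  obtain ⟨ha'R, ha'w, hdwa'⟩ := (hpart' a').1 (by rw [hTab']; simp)
  obtain ⟨hb'R, hb'w, hdwb'⟩ := (hpart' b').1 (by rw [hTab']; simp)
  obtain ⟨haj, hak, hdja, hdka⟩ := (hmemR a).1 haR
  obtain ⟨hbj, hbk, hdjb, hdkb⟩ := (hmemR b).1 hbR
  obtain ⟨ha'j, ha'k', hdja', hdk'a'⟩ := (hmemR' a').1 ha'R
  obtain ⟨hb'j, hb'k', hdjb', hdk'b'⟩ := (hmemR' b').1 hb'R
  -- all six are common neighbours of `(j, w)`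
  have hkS : k ∈ Sw := (hmemSw k).2 ⟨hjk.symm, Ne.symm hwk, hdjk, by rwa [dist_comm]⟩
  have hk'S : k' ∈ Sw := (hmemSw k').2 ⟨hjk'.symm, Ne.symm hwk', hdjk', by rwa [dist_comm]⟩
  have haS : a ∈ Sw := (hmemSw a).2 ⟨haj, haw, hdja, hdwa⟩
  have hbS : b ∈ Sw := (hmemSw b).2 ⟨hbj, hbw, hdjb, hdwb⟩
  have ha'S : a' ∈ Sw := (hmemSw a').2 ⟨ha'j, ha'w, hdja', hdwa'⟩
  have hb'S : b' ∈ Sw := (hmemSw b').2 ⟨hb'j, hb'w, hdjb', hdwb'⟩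
  -- distinctness across the two rings
  have hkk' : k ≠ k' := fun h => by rw [h, dist_self] at hfar; exact absurd hfar (by norm_num)
  have hka' : k ≠ a' := fun h => by rw [h, dist_comm] at hfar; exact absurd hdk'a' (not_le.mpr hfar)
  have hkb' : k ≠ b' := fun h => by rw [h, dist_comm] at hfar; exact absurd hdk'b' (not_le.mpr hfar)
  have hk'a : k' ≠ a := fun h => by rw [h] at hfar; exact absurd hdka (not_le.mpr hfar)
  have hk'b : k' ≠ b := fun h => by rw [h] at hfar; exact absurd hdkb (not_le.mpr hfar)
  have hle5 : Sw.card ≤ 5 := card_common_le_five x j w (Ne.symm hwj) hdjw hsep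
  -- either a fifth distinct element exists, or `{a', b'} ⊆ {a, b}`
  by_cases hextra : a' ∉ ({a, b} : Finset (Fin N)) ∨ b' ∉ ({a, b} : Finset (Fin N))
  · -- five distinct elements `k, k', a, b, c` of `Sw`
    obtain ⟨c, hcS, hck, hck', hca, hcb⟩ : ∃ c ∈ Sw, c ≠ k ∧ c ≠ k' ∧ c ≠ a ∧ c ≠ b := by
      rcases hextra with h | h
      · refine ⟨a', ha'S, Ne.symm hka', fun h' => ha'k' h', ?_, ?_⟩ <;> intro h' <;> apply h <;>
          simp [h']
      · refine ⟨b', hb'S, Ne.symm hkb', fun h' => hb'k' h', ?_, ?_⟩ <;> intro h' <;> apply h <;>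
          simp [h']
    refine le_antisymm hle5 ?_
    calc 5 = ({k, k', a, b, c} : Finset (Fin N)).card := by
          rw [Finset.card_insert_of_notMem, Finset.card_insert_of_notMem,
            Finset.card_insert_of_notMem, Finset.card_pair hcb.symm]
          · simp only [Finset.mem_insert, Finset.mem_singleton, not_or]
            exact ⟨hab, hca.symm⟩
          · simp only [Finset.mem_insert, Finset.mem_singleton, not_or]
            exact ⟨hk'a, hk'b, hck'.symm⟩
          · simp only [Finset.mem_insert, Finset.mem_singleton, not_or]
            exact ⟨hkk', Ne.symm hak, Ne.symm hbk, hck.symm⟩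
      _ ≤ Sw.card := Finset.card_le_card (by
          intro l hl
          simp only [Finset.mem_insert, Finset.mem_singleton] at hl
          rcases hl with rfl | rfl | rfl | rfl | rfl
          exacts [hkS, hk'S, haS, hbS, hcS])
  · -- `a', b' ∈ {a, b}`: then `a, b` are bonded to `k'` as well — contradiction in the frame
    exfalso
    rw [not_or, not_not, not_not] at hextra
    obtain ⟨ha'ab, hb'ab⟩ := hextra
    -- `{a', b'} = {a, b}` as sets of two elements, so `a, b ∈ R'`
    have haR' : a ∈ R' := by
      simp only [Finset.mem_insert, Finset.mem_singleton] at ha'ab hb'ab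
      rcases ha'ab with h | h
      · exact h ▸ ha'R
      · rcases hb'ab with h' | h'
        · exact h' ▸ hb'R
        · exact absurd (h.trans h'.symm) hab'
    have hbR' : b ∈ R' := by
      simp only [Finset.mem_insert, Finset.mem_singleton] at ha'ab hb'ab
      rcases hb'ab with h | h
      · rcases ha'ab with h' | h'
        · exact absurd (h'.trans h.symm) hab'
        · exact h' ▸ ha'R
      · exact h ▸ hb'R
    obtain ⟨-, -, -, hdk'a⟩ := (hmemR' a).1 haR'
    obtain ⟨-, -, -, hdk'b⟩ := (hmemR' b).1 hbR'
    -- `a–b` far: no bonded triangle `w, a, b` in the ring of `k`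
    have hab_far : 1 < dist (x a) (x b) := by
      by_contra h
      rw [not_lt] at h
      exact not_three_bonded_common x j k hjk hdjk hsep hw haR hbR (Ne.symm haw) (Ne.symm hbw) hab
        hdwa hdwb h
    -- the frame of the bond `(j, w)` on `T = {k, k', a, b}`
    have hsepj : ∀ k'' : Fin N, k'' ≠ j → (55 : ℝ) / 57 ≤ dist (x j) (x k'') :=
      hsep j (by rw [dist_self]; norm_num)
    have hmemT : ∀ l ∈ ({k, k', a, b} : Finset (Fin N)), l ∈ Sw := by
      intro l hl
      simp only [Finset.mem_insert, Finset.mem_singleton] at hl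
      rcases hl with rfl | rfl | rfl | rfl
      exacts [hkS, hk'S, haS, hbS]
    have hT : ∀ l ∈ ({k, k', a, b} : Finset (Fin N)), (55 : ℝ) / 57 ≤ dist (x j) (x l) ∧
        dist (x j) (x l) ≤ 1 ∧ (55 : ℝ) / 57 ≤ dist (x w) (x l) ∧ dist (x w) (x l) ≤ 1 := by
      intro l hl
      obtain ⟨hlj, hlw, hdjl, hdwl⟩ := (hmemSw l).1 (hmemT l hl)
      exact ⟨hsepj l hlj, hdjl, hsep w (by linarith) l hlw, hdwl⟩
    have hTT : ∀ l ∈ ({k, k', a, b} : Finset (Fin N)), ∀ l' ∈ ({k, k', a, b} : Finset (Fin N)),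
        l ≠ l' → (55 : ℝ) / 57 ≤ dist (x l) (x l') :=
      fun l hl l' _ hne => hsep l (by linarith [((hmemSw l).1 (hmemT l hl)).2.2.1]) l' hne.symm
    obtain ⟨z, hz1, -, hzfar, hzbond⟩ :=
      transversal_frame x j w (hsepj w hwj) hdjw {k, k', a, b} hT hTT
    have hkT : k ∈ ({k, k', a, b} : Finset (Fin N)) := by simp
    have hk'T : k' ∈ ({k, k', a, b} : Finset (Fin N)) := by simp
    have haT : a ∈ ({k, k', a, b} : Finset (Fin N)) := by simp
    have hbT : b ∈ ({k, k', a, b} : Finset (Fin N)) := by simp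
    have hkk'far : (131 : ℝ) / 100 ≤ dist (x k) (x k') := hgap k k' hdjk hdjk' hfar
    have habfar : (131 : ℝ) / 100 ≤ dist (x a) (x b) := hgap a b hdja hdjb hab_far
    exact not_cross_bonded_of_two_far_pairs (hz1 k hkT) (hz1 k' hk'T) (hz1 a haT) (hz1 b hbT)
      (hzfar k hkT k' hk'T hkk'far) (hzfar a haT b hbT habfar)
      (hzbond k hkT a haT hdka) (hzbond k hkT b hbT hdkb)
      (hzbond k' hk'T a haT hdk'a) (hzbond k' hk'T b hbT hdk'b)

/-- Registered closed form of the overlap lemma `card_eq_five_of_mem_inter` (S2β of line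
`Sketch`): two five-fold bonds `(j, k)`, `(j, k')` with `|x k - x k'| > 1` sharing a ring site
`w` force the adjacent bond `(j, w)` to be five-fold. [folklore] -/
theorem stub_fiveFoldOverlap :
    ∀ (N : ℕ) (x : Fin N → EuclideanSpace ℝ (Fin 3)) (j k k' w : Fin N),
      (∀ j' : Fin N, dist (x j) (x j') ≤ 11 / 10 → ∀ k'' : Fin N, k'' ≠ j' →
        (55 : ℝ) / 57 ≤ dist (x j') (x k'')) →
      (∀ l l' : Fin N, dist (x j) (x l) ≤ 1 → dist (x j) (x l') ≤ 1 → 1 < dist (x l) (x l') →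
        (131 : ℝ) / 100 ≤ dist (x l) (x l')) →
      j ≠ k → dist (x j) (x k) ≤ 1 →
      (Finset.univ.filter fun l : Fin N =>
          l ≠ j ∧ l ≠ k ∧ dist (x j) (x l) ≤ 1 ∧ dist (x k) (x l) ≤ 1).card = 5 →
      j ≠ k' → dist (x j) (x k') ≤ 1 →
      (Finset.univ.filter fun l : Fin N =>
          l ≠ j ∧ l ≠ k' ∧ dist (x j) (x l) ≤ 1 ∧ dist (x k') (x l) ≤ 1).card = 5 →
      1 < dist (x k) (x k') →
      w ∈ (Finset.univ.filter fun l : Fin N =>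
          l ≠ j ∧ l ≠ k ∧ dist (x j) (x l) ≤ 1 ∧ dist (x k) (x l) ≤ 1) →
      w ∈ (Finset.univ.filter fun l : Fin N =>
          l ≠ j ∧ l ≠ k' ∧ dist (x j) (x l) ≤ 1 ∧ dist (x k') (x l) ≤ 1) →
      (Finset.univ.filter fun l : Fin N =>
          l ≠ j ∧ l ≠ w ∧ dist (x j) (x l) ≤ 1 ∧ dist (x w) (x l) ≤ 1).card = 5 :=
  fun _ x j k k' w hsep hgap hjk hdjk h5 hjk' hdjk' h5' hfar hw hw' =>
    card_eq_five_of_mem_inter x j k k' hsep hgap hjk hdjk h5 hjk' hdjk' h5' hfar w hw hw'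

end Summit.AtomisticToContinuum.Crystallization.Theorems.SquareWellLayerCakeGapTwelveToBarlow

end
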